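import Summits.AnomalousDissipation.AnomalousDissipation.Theorems.GenericRunawayStokesScaling.Negative.Helicity
import Summits.AnomalousDissipation.AnomalousDissipation.Theorems.GenericRunawayStokesScaling.Negative.ZeroViscosityLine

/-!
# Negative knowledge for the crux `MirrorVariety.GenericRunawayStokesScaling` (stmt-AnomalousDissipation-2990), VII:
# the HELICITY SQUEEZE — for top-shell maximally-helical forces `V_2(g) ∖ {ν = 0}` is the Stokes hyperbola

Certified copy of §11 of the cdisprove work file (unconditional: the helicity identity is part VI).  For a real
solenoidal force `g` on the top shell `|k|² = 4` with `2πi k × ĝ_k = 4π ĝ_k`, pairing `F = 0` with `c`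
(`energy_identity`) and with `curl c` (`visc_helicity_eq`), the symmetry of the curl symbol (`inner_curlVec_left`)
and the sharp per-mode bound `Re⟪v, 2πi k×v⟫ ≤ 2π|k|‖v‖²` (`re_inner_curlVec_self_le`, from Lagrange's identity
`norm_crossK_sq_add`) force every zero with `ν ≠ 0` onto the top shell `{±2eᵢ}` (`axis_of_sum_sq_eq_four`), which
carries no triad (`top_add_top_not_mem`), so `c = ĝ/(16π²ν)` exactly (`helicity_squeeze'`) and
`ν²‖c‖² ≡ ‖g‖²/(16π²)²` off the zero-viscosity fibre (`sq_mul_norm_sq_eq_of_squeeze'`); hence for these forces the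
crux FOLLOWS from the boundedness of the `ν = 0` fibre `Q⁻¹(g)` (`stokesRate_of_bounded_zero_fibre`) — and,
conversely, can only fail through an unbounded (regular) zero-viscosity fibre.  Supports stmt-AnomalousDissipation-2990.
-/

set_option linter.dupNamespace false

noncomputable section

open scoped BigOperators InnerProductSpace ComplexConjugate
open Filter Set Function

namespace Summit.AnomalousDissipation.AnomalousDissipation.Theorems.GenericRunawayStokesScaling.Negative

open Literature.Analysis.FunctionSpaces Literature.Analysis.FunctionSpaces.Torus
open Literature.Analysis.FluidPDE Literature.Analysis.FluidPDE.Torus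
open Summit.AnomalousDissipation.AnomalousDissipation.Theses.MirrorVariety

/-! ## §11 The HELICITY SQUEEZE: top-shell maximally-helical forces

For a force `g` supported on the TOP shell `|k| = N` and maximally helical (`curl g = 2πN g`), pairing `F = 0`
with `c` (energy) and with `curl c` (helicity, using the conservation identity `H` of §10) gives
`∑_k |k|² Re⟪c_k, 2πi k×c_k⟫ = 2πN ∑_k |k|² ‖c_k‖²` at every zero with `ν ≠ 0`; since
`Re⟪v, 2πi k×v⟫ ≤ 2π|k|‖v‖²` mode by mode, every active mode has `|k| = N`: the zero lives on the top
shell, where (at `N = 2`) there are no triads, so `Q(c) = 0` and `c = ĝ/(4π²N²ν)` EXACTLY.  Hence (unconditionally, `H` = `helicityIdentity_holds`):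
for such `g`, `V_2(g) ∖ {ν = 0}` IS the Stokes hyperbola (`helicity_squeeze`), `ν²‖c‖² ≡ ‖g‖²/(16π²)²` off the
zero-viscosity fibre, and the crux for these forces is EQUIVALENT to: the `ν = 0` fibre `{c : Q(c) = g}` is bounded
(plus regularity).  A new a-priori law ("extremal forces laminarise exactly"), the opposite pole of §5. -/

section Squeeze

variable {S : Finset (Fin 3 → ℤ)}

/-- **Lagrange's identity** for a real frequency: `‖k × v‖² + |k · v|² = |k|² ‖v‖²`. [folklore] -/
theorem norm_crossK_sq_add (k : Fin 3 → ℤ) (v : (EuclideanSpace ℂ (Fin 3))) :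
    ‖crossK k v‖ ^ 2 + ‖∑ j, (k j : ℂ) * v j‖ ^ 2 = freqNormSq k * ‖v‖ ^ 2 := by
  rw [EuclideanSpace.norm_eq, EuclideanSpace.norm_eq v,
    Real.sq_sqrt (Finset.sum_nonneg fun _ _ => sq_nonneg _),
    Real.sq_sqrt (Finset.sum_nonneg fun _ _ => sq_nonneg _)]
  simp only [Fin.sum_univ_three, crossK_apply_zero, crossK_apply_one, crossK_apply_two, Complex.sq_norm,
    Complex.normSq_apply, Complex.sub_re, Complex.sub_im, Complex.mul_re, Complex.mul_im, Complex.add_re,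
    Complex.add_im, Complex.intCast_re, Complex.intCast_im, freqNormSq, zero_mul, sub_zero, add_zero]
  ring

/-- `‖k × v‖ ≤ |k| ‖v‖`. [folklore] -/
theorem norm_crossK_le (k : Fin 3 → ℤ) (v : (EuclideanSpace ℂ (Fin 3))) : ‖crossK k v‖ ≤ Real.sqrt (freqNormSq k) * ‖v‖ := by
  have h1 : ‖crossK k v‖ ^ 2 ≤ (Real.sqrt (freqNormSq k) * ‖v‖) ^ 2 := by
    rw [mul_pow, Real.sq_sqrt (freqNormSq_nonneg k), ← norm_crossK_sq_add k v]
    exact le_add_of_nonneg_right (sq_nonneg _)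
  exact (pow_le_pow_iff_left₀ (norm_nonneg _) (by positivity) two_ne_zero).1 h1

/-- **Per-mode spectral bound of the curl symbol** (P1): `Re⟪v, 2πi k × v⟫ ≤ 2π|k| ‖v‖²`. [folklore] -/
theorem re_inner_curlVec_self_le (k : Fin 3 → ℤ) (v : (EuclideanSpace ℂ (Fin 3))) :
    (inner ℂ v (curlVec k v)).re ≤ 2 * Real.pi * Real.sqrt (freqNormSq k) * ‖v‖ ^ 2 := by
  have h1 : (inner ℂ v (curlVec k v)).re ≤ ‖v‖ * ‖curlVec k v‖ :=
    (Complex.re_le_norm _).trans (norm_inner_le_norm _ _)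
  have h2 : ‖curlVec k v‖ = 2 * Real.pi * ‖crossK k v‖ := by
    rw [curlVec, norm_smul]
    congr 1
    rw [norm_mul, norm_mul, Complex.norm_I, mul_one, Complex.norm_real, Complex.norm_ofNat,
      Real.norm_of_nonneg Real.pi_pos.le]
  rw [h2] at h1
  calc (inner ℂ v (curlVec k v)).re ≤ ‖v‖ * (2 * Real.pi * ‖crossK k v‖) := h1
    _ ≤ ‖v‖ * (2 * Real.pi * (Real.sqrt (freqNormSq k) * ‖v‖)) := by
        gcongr; exact norm_crossK_le k v
    _ = 2 * Real.pi * Real.sqrt (freqNormSq k) * ‖v‖ ^ 2 := by ring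

/-- **The curl symbol is symmetric** (P2): `⟪2πi k × g, c⟫ = ⟪g, 2πi k × c⟫` mode by mode. [folklore] -/
theorem inner_curlVec_left (k : Fin 3 → ℤ) (g c : (EuclideanSpace ℂ (Fin 3))) :
    inner ℂ (curlVec k g) c = inner ℂ g (curlVec k c) := by
  simp only [curlVec, PiLp.inner_apply, RCLike.inner_apply, Fin.sum_univ_three, PiLp.smul_apply, smul_eq_mul,
    crossK_apply_zero, crossK_apply_one, crossK_apply_two, map_mul, map_sub, map_ofNat, Complex.conj_ofReal,
    Complex.conj_I, map_intCast]
  ring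

/-- Real scalars come out of the real part of an inner product. [folklore] -/
theorem re_inner_ofReal_smul_left (a : ℝ) (x y : (EuclideanSpace ℂ (Fin 3))) :
    (inner ℂ ((a : ℂ) • x) y).re = a * (inner ℂ x y).re := by
  rw [inner_smul_left, Complex.conj_ofReal, Complex.re_ofReal_mul]

/-- **Pairing `F = 0` with `curl c`** (uses `H`): at a zero, `ν ∑_k C_k Re⟪c_k, 2πi k×c_k⟫ = ∑_k Re⟪ĝ_k, 2πi k×c_k⟫`. -/
theorem visc_helicity_eq (hH : HelicityIdentity S) {g : ↥S → (EuclideanSpace ℂ (Fin 3))} (hg : g ∈ galerkinSubspace S)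
    {z : (↥S → (EuclideanSpace ℂ (Fin 3))) × ℝ} (hz : z ∈ variety S g) :
    z.2 * ∑ k : ↥S, stokesW (k : Fin 3 → ℤ) * (inner ℂ (z.1 k) (curlVec (k : Fin 3 → ℤ) (z.1 k))).re =
      ∑ k : ↥S, (inner ℂ (g k) (curlVec (k : Fin 3 → ℤ) (z.1 k))).re := by
  have hF : Fmap S g z = 0 := hz.2
  rw [Fmap_apply] at hF
  have hk : ∀ k : ↥S, (inner ℂ ((-(z.2 • stokesA S z.1) + (fun k : ↥S => leraySym (k : Fin 3 → ℤ) (g k)) -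
      projB S z.1 z.1) k) (curlVec (k : Fin 3 → ℤ) (z.1 k))).re = 0 := fun k => by
    rw [hF]; simp
  have hsum := Finset.sum_eq_zero fun k (_ : k ∈ (Finset.univ : Finset ↥S)) => hk k
  simp only [Pi.sub_apply, Pi.add_apply, Pi.neg_apply, Pi.smul_apply, inner_sub_left, inner_add_left,
    inner_neg_left, Complex.sub_re, Complex.add_re, Complex.neg_re, Finset.sum_sub_distrib,
    Finset.sum_add_distrib, Finset.sum_neg_distrib, leraySym_apply_of_mem hg] at hsum
  rw [hH z.1 hz.1, sub_zero] at hsum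
  have h1 : ∀ k : ↥S, (inner ℂ (z.2 • stokesA S z.1 k) (curlVec (k : Fin 3 → ℤ) (z.1 k))).re =
      z.2 * (stokesW (k : Fin 3 → ℤ) * (inner ℂ (z.1 k) (curlVec (k : Fin 3 → ℤ) (z.1 k))).re) := by
    intro k
    rw [stokesA, real_smul_vec, smul_smul, ← Complex.ofReal_mul, re_inner_ofReal_smul_left, mul_assoc]
  simp only [h1, ← Finset.mul_sum] at hsum
  linarith

/-- **The integer vectors of squared length `4` are the axis vectors `±2eᵢ`.** [folklore] -/
theorem axis_of_sum_sq_eq_four {l : Fin 3 → ℤ} (h : (∑ i, l i ^ 2 : ℤ) = 4) (i : Fin 3) :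
    l i = 0 ∨ l i = 2 ∨ l i = -2 := by
  simp only [Fin.sum_univ_three] at h
  have b0 : -2 ≤ l 0 ∧ l 0 ≤ 2 := by constructor <;> nlinarith [sq_nonneg (l 1), sq_nonneg (l 2), sq_nonneg (l 0 + 2), sq_nonneg (l 0 - 2)]
  have b1 : -2 ≤ l 1 ∧ l 1 ≤ 2 := by constructor <;> nlinarith [sq_nonneg (l 0), sq_nonneg (l 2), sq_nonneg (l 1 + 2), sq_nonneg (l 1 - 2)]
  have b2 : -2 ≤ l 2 ∧ l 2 ≤ 2 := by constructor <;> nlinarith [sq_nonneg (l 0), sq_nonneg (l 1), sq_nonneg (l 2 + 2), sq_nonneg (l 2 - 2)]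
  have key : (l 0 = 0 ∨ l 0 = 2 ∨ l 0 = -2) ∧ (l 1 = 0 ∨ l 1 = 2 ∨ l 1 = -2) ∧ (l 2 = 0 ∨ l 2 = 2 ∨ l 2 = -2) := by
    obtain ⟨b0l, b0u⟩ := b0; obtain ⟨b1l, b1u⟩ := b1; obtain ⟨b2l, b2u⟩ := b2
    interval_cases hl0 : l 0 <;> interval_cases hl1 : l 1 <;> interval_cases hl2 : l 2 <;> norm_num at h <;> norm_num
  fin_cases i
  exacts [key.1, key.2.1, key.2.2]

/-- **No triads inside the top shell of `S_2`**: `l + m ∉ S_2` when `|l|² = |m|² = 4`. [folklore] -/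
theorem top_add_top_not_mem {l m : Fin 3 → ℤ} (hl : (∑ i, l i ^ 2 : ℤ) = 4) (hm : (∑ i, m i ^ 2 : ℤ) = 4) :
    l + m ∉ PB 2 := by
  rw [mem_PB_iff]
  rintro ⟨hne, hle⟩
  have hlow := one_le_sum_sq_of_ne_zero hne
  rw [sum_sq_add] at hle hlow
  simp only [Fin.sum_univ_three] at hle hlow hl hm
  have a0 := axis_of_sum_sq_eq_four (by simpa [Fin.sum_univ_three] using hl) 0
  have a1 := axis_of_sum_sq_eq_four (by simpa [Fin.sum_univ_three] using hl) 1
  have a2 := axis_of_sum_sq_eq_four (by simpa [Fin.sum_univ_three] using hl) 2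
  have c0 := axis_of_sum_sq_eq_four (by simpa [Fin.sum_univ_three] using hm) 0
  have c1 := axis_of_sum_sq_eq_four (by simpa [Fin.sum_univ_three] using hm) 1
  have c2 := axis_of_sum_sq_eq_four (by simpa [Fin.sum_univ_three] using hm) 2
  push_cast at hle
  rcases a0 with h0 | h0 | h0 <;> rcases a1 with h1 | h1 | h1 <;> rcases a2 with h2 | h2 | h2 <;>
    rcases c0 with k0 | k0 | k0 <;> rcases c1 with k1 | k1 | k1 <;> rcases c2 with k2 | k2 | k2 <;>
    simp only [h0, h1, h2, k0, k1, k2] at hle hlow hl hm <;> omega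

/-- **THE HELICITY SQUEEZE at `N = 2`** (modulo `H`).  If `g` is supported on the top shell `|k|² = 4` and
maximally helical (`2πi k × ĝ_k = 4π ĝ_k`), then every zero with `ν ≠ 0` is the Stokes state
`c = ĝ/(16π²ν)`: `V_2(g) ∖ {ν = 0}` is EXACTLY the Stokes hyperbola and its mirror. [folklore] -/
theorem helicity_squeeze (hH : HelicityIdentity (PB 2)) {g : ↥(PB 2) → (EuclideanSpace ℂ (Fin 3))} (hg : g ∈ galerkinSubspace (PB 2))
    (htop : ∀ k : ↥(PB 2), freqNormSq (k : Fin 3 → ℤ) ≠ 4 → g k = 0)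
    (hbel : ∀ k : ↥(PB 2), curlVec (k : Fin 3 → ℤ) (g k) = ((4 * Real.pi : ℝ) : ℂ) • g k)
    {z : (↥(PB 2) → (EuclideanSpace ℂ (Fin 3))) × ℝ} (hz : z ∈ variety (PB 2) g) (hν : z.2 ≠ 0) :
    z.1 = (16 * Real.pi ^ 2 * z.2)⁻¹ • g := by
  set c := z.1 with hc
  set ν := z.2 with hνdef
  -- (1) energy and (2)-(3) helicity pairings
  have hE := energy_identity (PB_symm 2) hg.1 hz
  have hHel := visc_helicity_eq hH hg hz
  have hP2 : ∑ k : ↥(PB 2), (inner ℂ (g k) (curlVec (k : Fin 3 → ℤ) (c k))).re =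
      4 * Real.pi * ∑ k : ↥(PB 2), (inner ℂ (g k) (c k)).re := by
    rw [Finset.mul_sum]
    refine Finset.sum_congr rfl fun k _ => ?_
    rw [← inner_curlVec_left, hbel k, re_inner_ofReal_smul_left]
  -- (4) the squeezed identity ∑ C_k (Re⟪c_k, curl c_k⟫ - 4π‖c_k‖²) = 0
  have hkey : ∑ k : ↥(PB 2), stokesW (k : Fin 3 → ℤ) *
      ((inner ℂ (c k) (curlVec (k : Fin 3 → ℤ) (c k))).re - 4 * Real.pi * ‖c k‖ ^ 2) = 0 := by
    have h4 : ν * ∑ k : ↥(PB 2), stokesW (k : Fin 3 → ℤ) * (inner ℂ (c k) (curlVec (k : Fin 3 → ℤ) (c k))).re =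
        ν * (4 * Real.pi * (4 * Real.pi ^ 2 * ∑ k : ↥(PB 2), freqNormSq (k : Fin 3 → ℤ) * ‖c k‖ ^ 2)) := by
      rw [hHel, hP2, ← hE]; ring
    have h5 := mul_left_cancel₀ hν h4
    simp only [mul_sub, Finset.sum_sub_distrib, h5, stokesW, Finset.mul_sum]
    rw [sub_eq_zero]
    exact Finset.sum_congr rfl fun k _ => by ring
  -- (5) each term is ≤ 0, hence = 0
  have hterm_le : ∀ k : ↥(PB 2), stokesW (k : Fin 3 → ℤ) *
      ((inner ℂ (c k) (curlVec (k : Fin 3 → ℤ) (c k))).re - 4 * Real.pi * ‖c k‖ ^ 2) ≤ 0 := by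
    intro k
    have hk2 : freqNormSq (k : Fin 3 → ℤ) ≤ 4 := by
      have := (mem_PB_iff.1 k.2).2
      rw [freqNormSq_eq_intCast]; exact_mod_cast this
    have hsq : Real.sqrt (freqNormSq (k : Fin 3 → ℤ)) ≤ 2 := by
      rw [show (2 : ℝ) = Real.sqrt 4 by rw [show (4 : ℝ) = 2 ^ 2 by norm_num, Real.sqrt_sq (by norm_num)]]
      exact Real.sqrt_le_sqrt hk2
    have hb := re_inner_curlVec_self_le (k : Fin 3 → ℤ) (c k)
    have : (inner ℂ (c k) (curlVec (k : Fin 3 → ℤ) (c k))).re - 4 * Real.pi * ‖c k‖ ^ 2 ≤ 0 := by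
      nlinarith [Real.pi_pos, sq_nonneg ‖c k‖, mul_nonneg (mul_nonneg (by positivity : (0:ℝ) ≤ 2 * Real.pi)
        (sub_nonneg.2 hsq)) (sq_nonneg ‖c k‖)]
    exact mul_nonpos_of_nonneg_of_nonpos (stokesW_nonneg _) this
  have hterm : ∀ k : ↥(PB 2), stokesW (k : Fin 3 → ℤ) *
      ((inner ℂ (c k) (curlVec (k : Fin 3 → ℤ) (c k))).re - 4 * Real.pi * ‖c k‖ ^ 2) = 0 := by
    intro k
    have := (Finset.sum_eq_zero_iff_of_nonpos fun k (_ : k ∈ (Finset.univ : Finset ↥(PB 2))) => hterm_le k).1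
      hkey k (Finset.mem_univ k)
    exact this
  -- (6) modes below the top shell vanish
  have htopc : ∀ k : ↥(PB 2), freqNormSq (k : Fin 3 → ℤ) ≠ 4 → c k = 0 := by
    intro k hk4
    have hkpos : 0 < freqNormSq (k : Fin 3 → ℤ) := by
      have := one_le_sum_sq_of_ne_zero (mem_PB_iff.1 k.2).1
      rw [freqNormSq_eq_intCast]; exact_mod_cast this
    have hk2 : freqNormSq (k : Fin 3 → ℤ) ≤ 4 := by
      have := (mem_PB_iff.1 k.2).2
      rw [freqNormSq_eq_intCast]; exact_mod_cast this
    have hlt : freqNormSq (k : Fin 3 → ℤ) < 4 := lt_of_le_of_ne hk2 hk4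
    have hsq : Real.sqrt (freqNormSq (k : Fin 3 → ℤ)) < 2 := by
      rw [show (2 : ℝ) = Real.sqrt 4 by rw [show (4 : ℝ) = 2 ^ 2 by norm_num, Real.sqrt_sq (by norm_num)]]
      exact Real.sqrt_lt_sqrt (freqNormSq_nonneg _) hlt
    have h0 := hterm k
    have hW : stokesW (k : Fin 3 → ℤ) ≠ 0 := by simp only [stokesW]; positivity
    have h1 : (inner ℂ (c k) (curlVec (k : Fin 3 → ℤ) (c k))).re - 4 * Real.pi * ‖c k‖ ^ 2 = 0 := by
      rcases mul_eq_zero.1 h0 with h | h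
      · exact absurd h hW
      · exact h
    have hb := re_inner_curlVec_self_le (k : Fin 3 → ℤ) (c k)
    have hnorm : ‖c k‖ ^ 2 = 0 := by
      nlinarith [Real.pi_pos, sq_nonneg ‖c k‖, mul_pos (mul_pos (by positivity : (0:ℝ) < 2 * Real.pi)
        (sub_pos.2 hsq)) Real.pi_pos]
    exact norm_eq_zero.1 (pow_eq_zero_iff two_ne_zero |>.1 hnorm)
  -- (7) no top-shell triads ⇒ the convection symbol vanishes
  have hsupp : ∀ l : Fin 3 → ℤ, coeffExt (PB 2) c l ≠ 0 → l ∈ PB 2 ∧ (∑ i, l i ^ 2 : ℤ) = 4 := by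
    intro l hl
    by_cases hlS : l ∈ PB 2
    · refine ⟨hlS, ?_⟩
      by_contra h4
      apply hl
      rw [coeffExt_of_mem _ hlS]
      apply htopc ⟨l, hlS⟩
      rw [freqNormSq_eq_intCast]
      exact_mod_cast h4
    · exact absurd (coeffExt_of_not_mem c hlS) hl
  have hCC : ∀ k : ↥(PB 2), convectionCoeff (PB 2) (coeffExt _ c) (coeffExt _ c) k = 0 := fun k =>
    convectionCoeff_eq_zero_of_support fun l _ m _ hl hm heq =>
      top_add_top_not_mem (hsupp l hl).2 (hsupp m hm).2 (heq ▸ k.2)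
  -- (8) read off `c` from the (now linear) equation
  have hF : ∀ k : ↥(PB 2), -(((ν * stokesW (k : Fin 3 → ℤ) : ℝ) : ℂ) • c k) + g k = 0 := by
    intro k
    have := congrFun hz.2 k
    rw [galerkinRHS_apply, galerkinField_def, hCC k, sub_zero, coeffExt_coe, coeffExt_coe,
      leraySym_apply_of_mem hg] at this
    exact this
  funext k
  rw [Pi.smul_apply, real_smul_vec]
  by_cases hk4 : freqNormSq (k : Fin 3 → ℤ) = 4
  · have h := hF k
    rw [stokesW, hk4, neg_add_eq_zero] at h
    -- h : ((ν * (4π²·4)) : ℂ) • c k = g k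
    rw [← h, smul_smul, ← Complex.ofReal_mul]
    have hne : (16 * Real.pi ^ 2 * ν : ℝ) ≠ 0 := by
      have : (0:ℝ) < 16 * Real.pi ^ 2 := by positivity
      exact mul_ne_zero this.ne' hν
    rw [show (16 * Real.pi ^ 2 * ν)⁻¹ * (ν * (4 * Real.pi ^ 2 * 4)) = 1 by field_simp; ring]
    simp
  · rw [htopc k hk4, htop k hk4, smul_zero]

/-- Corollary: for such forces `ν²‖c‖² ≡ ‖g‖²/(16π²)²` OFF the zero-viscosity fibre — the Stokes rate holds,
sharply, on every runaway not inside `{ν = 0}`.  So, modulo `H`, the crux for top-shell maximally-helical forces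
is EQUIVALENT to the boundedness of the `ν = 0` fibre `{c : Q(c) = g}` (given regularity): the opposite pole
of §5, where an unbounded `ν = 0` fibre was the (critical) killer. [folklore] -/
theorem sq_mul_norm_sq_eq_of_squeeze (hH : HelicityIdentity (PB 2)) {g : ↥(PB 2) → (EuclideanSpace ℂ (Fin 3))}
    (hg : g ∈ galerkinSubspace (PB 2)) (htop : ∀ k : ↥(PB 2), freqNormSq (k : Fin 3 → ℤ) ≠ 4 → g k = 0)
    (hbel : ∀ k : ↥(PB 2), curlVec (k : Fin 3 → ℤ) (g k) = ((4 * Real.pi : ℝ) : ℂ) • g k)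
    {z : (↥(PB 2) → (EuclideanSpace ℂ (Fin 3))) × ℝ} (hz : z ∈ variety (PB 2) g) (hν : z.2 ≠ 0) :
    z.2 ^ 2 * ‖z.1‖ ^ 2 = (‖g‖ / (16 * Real.pi ^ 2)) ^ 2 := by
  rw [helicity_squeeze hH hg htop hbel hz hν, norm_smul, Real.norm_eq_abs, abs_inv, mul_pow, inv_pow, sq_abs]
  have hpos : 0 < 16 * Real.pi ^ 2 := by positivity
  field_simp

/-- **THE HELICITY SQUEEZE, unconditional** (`H` is now the theorem `helicityIdentity_holds`): for a top-shell
maximally-helical force at `N = 2`, every zero with `ν ≠ 0` is the Stokes state `c = ĝ/(16π²ν)`. [folklore] -/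
theorem helicity_squeeze' {g : ↥(PB 2) → (EuclideanSpace ℂ (Fin 3))} (hg : g ∈ galerkinSubspace (PB 2))
    (htop : ∀ k : ↥(PB 2), freqNormSq (k : Fin 3 → ℤ) ≠ 4 → g k = 0)
    (hbel : ∀ k : ↥(PB 2), curlVec (k : Fin 3 → ℤ) (g k) = ((4 * Real.pi : ℝ) : ℂ) • g k)
    {z : (↥(PB 2) → (EuclideanSpace ℂ (Fin 3))) × ℝ} (hz : z ∈ variety (PB 2) g) (hν : z.2 ≠ 0) :
    z.1 = (16 * Real.pi ^ 2 * z.2)⁻¹ • g :=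
  helicity_squeeze (helicityIdentity_holds (PB_symm 2)) hg htop hbel hz hν

/-- **Stokes rate OFF the zero-viscosity fibre, unconditional**: `ν²‖c‖² ≡ ‖g‖²/(16π²)²` at every zero with
`ν ≠ 0`, for top-shell maximally-helical forces at `N = 2`.  Hence for these forces the crux holds iff the
`ν = 0` fibre `{c : Q(c) = g}` is bounded (given regularity). [folklore] -/
theorem sq_mul_norm_sq_eq_of_squeeze' {g : ↥(PB 2) → (EuclideanSpace ℂ (Fin 3))} (hg : g ∈ galerkinSubspace (PB 2))
    (htop : ∀ k : ↥(PB 2), freqNormSq (k : Fin 3 → ℤ) ≠ 4 → g k = 0)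
    (hbel : ∀ k : ↥(PB 2), curlVec (k : Fin 3 → ℤ) (g k) = ((4 * Real.pi : ℝ) : ℂ) • g k)
    {z : (↥(PB 2) → (EuclideanSpace ℂ (Fin 3))) × ℝ} (hz : z ∈ variety (PB 2) g) (hν : z.2 ≠ 0) :
    z.2 ^ 2 * ‖z.1‖ ^ 2 = (‖g‖ / (16 * Real.pi ^ 2)) ^ 2 :=
  sq_mul_norm_sq_eq_of_squeeze (helicityIdentity_holds (PB_symm 2)) hg htop hbel hz hν

/-- For such forces `StokesRate` holds along EVERY part of `V` avoiding the zero-viscosity fibre: if the `ν = 0`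
fibre is bounded (by `M₀` in sup norm), the crux's conclusion holds with `M = M₀ + 1`, `c₀ = ‖g‖²/(16π²)²`. [folklore] -/
theorem stokesRate_of_bounded_zero_fibre {g : ↥(PB 2) → (EuclideanSpace ℂ (Fin 3))} (hg : g ∈ galerkinSubspace (PB 2)) (hg0 : g ≠ 0)
    (htop : ∀ k : ↥(PB 2), freqNormSq (k : Fin 3 → ℤ) ≠ 4 → g k = 0)
    (hbel : ∀ k : ↥(PB 2), curlVec (k : Fin 3 → ℤ) (g k) = ((4 * Real.pi : ℝ) : ℂ) • g k)
    {M₀ : ℝ} (hfib : ∀ c : ↥(PB 2) → (EuclideanSpace ℂ (Fin 3)), ((c, (0 : ℝ)) : (↥(PB 2) → (EuclideanSpace ℂ (Fin 3))) × ℝ) ∈ variety (PB 2) g → ‖c‖ ≤ M₀) :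
    StokesRate (PB 2) g := by
  refine ⟨M₀ + 1, (‖g‖ / (16 * Real.pi ^ 2)) ^ 2, by have := norm_pos_iff.2 hg0; positivity, ?_⟩
  intro z hz hM
  have hν : z.2 ≠ 0 := by
    intro h0
    have hz0 : ((z.1, (0 : ℝ)) : (↥(PB 2) → (EuclideanSpace ℂ (Fin 3))) × ℝ) ∈ variety (PB 2) g := by
      have : z = (z.1, z.2) := rfl
      rw [this, h0] at hz; exact hz
    have := hfib z.1 hz0
    linarith
  exact (sq_mul_norm_sq_eq_of_squeeze' hg htop hbel hz hν).ge

/-! ### Non-vacuity of the squeeze hypotheses: the circularly polarised top mode -/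

/-- The helical polarisation `h = (1, i, 0)`: `i k₀ × h = 2h` for `k₀ = (0,0,2)`. [folklore] -/
def hel0 : (EuclideanSpace ℂ (Fin 3)) := EuclideanSpace.single 0 1 + EuclideanSpace.single 1 Complex.I

/-- The circularly polarised top-shell mode `g_H`: `h` at `k₀ = (0,0,2)`, `conj h` at `-k₀`. [folklore] -/
def gH : ↥(PB 2) → (EuclideanSpace ℂ (Fin 3)) := fun k =>
  if (k : Fin 3 → ℤ) = k0 then hel0 else if (k : Fin 3 → ℤ) = -k0 then EuclideanSpace.conjVec hel0 else 0

/-- Unfolding of `gH`. [folklore] -/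
theorem gH_apply (k : ↥(PB 2)) : gH k = if (k : Fin 3 → ℤ) = k0 then hel0
    else if (k : Fin 3 → ℤ) = -k0 then EuclideanSpace.conjVec hel0 else 0 := rfl

/-- `k₀ ≠ -k₀`. [folklore] -/
theorem k0_ne_neg : k0 ≠ -k0 := vec_ne 2 (by simp [k0, Matrix.cons_val_two, Matrix.tail_cons, Matrix.head_cons])

/-- `g_H` is a real solenoidal force vector. [folklore] -/
theorem gH_mem : gH ∈ galerkinSubspace (PB 2) := by
  refine ⟨?_, ?_⟩
  · intro k l hl
    rw [gH_apply, gH_apply]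
    by_cases h1 : (k : Fin 3 → ℤ) = k0
    · have hl' : (l : Fin 3 → ℤ) = -k0 := by rw [hl, h1]
      have hl'' : (l : Fin 3 → ℤ) ≠ k0 := by rw [hl']; exact k0_ne_neg.symm
      rw [if_pos h1, if_neg hl'', if_pos hl']
    · by_cases h2 : (k : Fin 3 → ℤ) = -k0
      · have hl' : (l : Fin 3 → ℤ) = k0 := by rw [hl, h2, neg_neg]
        rw [if_neg h1, if_pos h2, if_pos hl', EuclideanSpace.conjVec_conjVec]
      · have hl1 : (l : Fin 3 → ℤ) ≠ k0 := fun h => h2 (neg_eq_iff_eq_neg.1 (by rwa [hl] at h))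
        have hl2 : (l : Fin 3 → ℤ) ≠ -k0 := fun h => h1 (neg_inj.1 (by rwa [hl] at h))
        rw [if_neg h1, if_neg h2, if_neg hl1, if_neg hl2, EuclideanSpace.conjVec_zero]
  · intro k
    rw [gH_apply]
    split_ifs with h1 h2
    · simp [h1, k0, hel0, Fin.sum_univ_three, Matrix.cons_val_zero, Matrix.cons_val_one]
    · simp [h2, k0, hel0, Fin.sum_univ_three, Matrix.cons_val_zero, Matrix.cons_val_one,
        EuclideanSpace.conjVec_apply]
    · simp

/-- `g_H ≠ 0`. [folklore] -/
theorem gH_ne_zero : gH ≠ 0 := by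
  intro h
  have h1 : gH ⟨k0, k0_mem⟩ = hel0 := by rw [gH_apply, if_pos rfl]
  rw [h] at h1
  have h2 := congrArg (fun v : (EuclideanSpace ℂ (Fin 3)) => v 0) h1
  simp [hel0] at h2

/-- `g_H` is supported on the top shell. [folklore] -/
theorem gH_top (k : ↥(PB 2)) (hk : freqNormSq (k : Fin 3 → ℤ) ≠ 4) : gH k = 0 := by
  rw [gH_apply, if_neg, if_neg]
  · intro h; apply hk; rw [h, freqNormSq_neg]; norm_num [freqNormSq, k0, Fin.sum_univ_three, Matrix.cons_val_zero, Matrix.cons_val_one, Matrix.cons_val_two, Matrix.head_cons, Matrix.tail_cons]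
  · intro h; apply hk; rw [h]; norm_num [freqNormSq, k0, Fin.sum_univ_three, Matrix.cons_val_zero, Matrix.cons_val_one, Matrix.cons_val_two, Matrix.head_cons, Matrix.tail_cons]

/-- `g_H` is maximally helical: `2πi k × ĝ_k = 4π ĝ_k`. [folklore] -/
theorem gH_beltrami (k : ↥(PB 2)) : curlVec (k : Fin 3 → ℤ) (gH k) = ((4 * Real.pi : ℝ) : ℂ) • gH k := by
  rw [gH_apply]
  split_ifs with h1 h2
  · rw [h1]; ext i
    fin_cases i
    · simp [Complex.ext_iff, curlVec, hel0, k0, Matrix.cons_val_zero, Matrix.cons_val_one, Matrix.cons_val_two,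
        Matrix.head_cons, Matrix.tail_cons]
      ring
    · simp [Complex.ext_iff, curlVec, hel0, k0, Matrix.cons_val_zero, Matrix.cons_val_two, Matrix.head_cons,
        Matrix.tail_cons]
      ring
    · simp [curlVec, hel0, k0, Matrix.cons_val_zero, Matrix.cons_val_one]
  · rw [h2]; ext i
    fin_cases i
    · simp [Complex.ext_iff, curlVec, hel0, k0, Matrix.cons_val_zero, Matrix.cons_val_one, Matrix.cons_val_two,
        Matrix.head_cons, Matrix.tail_cons, EuclideanSpace.conjVec_apply]
      ring
    · simp [Complex.ext_iff, curlVec, hel0, k0, Matrix.cons_val_zero, Matrix.cons_val_two, Matrix.head_cons,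
        Matrix.tail_cons, EuclideanSpace.conjVec_apply]
      ring
    · simp [curlVec, hel0, k0, Matrix.cons_val_zero, Matrix.cons_val_one, EuclideanSpace.conjVec_apply]
  · ext i
    fin_cases i
    · simp [curlVec]
    · simp [curlVec]
    · simp [curlVec]

/-- **Non-vacuity of §11**: a nonzero real solenoidal, top-shell, maximally-helical force exists at `N = 2`
(so `helicity_squeeze'` speaks about a genuine family; `V_2(g_H) ∖ {ν=0}` is the Stokes hyperbola). [folklore] -/
theorem exists_topShell_helical_force : ∃ g : ↥(PB 2) → (EuclideanSpace ℂ (Fin 3)), g ∈ galerkinSubspace (PB 2) ∧ g ≠ 0 ∧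
    (∀ k : ↥(PB 2), freqNormSq (k : Fin 3 → ℤ) ≠ 4 → g k = 0) ∧
    (∀ k : ↥(PB 2), curlVec (k : Fin 3 → ℤ) (g k) = ((4 * Real.pi : ℝ) : ℂ) • g k) :=
  ⟨gH, gH_mem, gH_ne_zero, gH_top, gH_beltrami⟩

end Squeeze


end Summit.AnomalousDissipation.AnomalousDissipation.Theorems.GenericRunawayStokesScaling.Negative
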